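import Summits.QuantumFields.YangMills.Theorems.BalabanUVNodesN22AtRecordOfKernelFadingActivityMargins
import Summits.QuantumFields.YangMills.Theorems.BalabanUVNodesN22AtRecordOfOutputCoordHoloPrinted

/-!
# NODE N22 (NE9) — «J33-3 AT THE RECORD, REPAIRED» IN PRINT-LEVEL CURRENCY: K3's `h9` WITH THE RECORD's GEOMETRIC MODULI and the N22 pin face from node N18's kernel step rate +
# OLDER-coordinate ACTIVITY margins with ONE radius + node N09's `EHoloAt` families + PRINTED (2.38) + PRINTED configuration analyticity `AnalyticH` ([II] p. 15) at the record's
# space tables `U^c_{k+1}(Z, α₀, α₁)` — dag-n22-c g14's J43 `ne9_EA_objectsOfRecord₁₃_of_kernelStepRate_olderActivityCoordHolo_eHoloAt` with its ONE non-print STRUCTURAL binder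
# (term holomorphy through the readings) DISCHARGED by this lineage's p621851 §0

Cell `pub-ymgap`, Track A (HUMAN RULING D-0062), WIDTH SEAT `dag-n22-w5` (g2, harness re-seat of base w5) on node n22 = NE9, D-0154 (3a) second width wave;
`--kind proof --supports stmt-QuantumFields-27366 --as helper` (KEY MAP v2, pub-ymgap INBOX 2026-08-28T10:04Z: K3⁸ `SpineGivenEndpointR13SepCoPHV`, skeleton v6 b4e55110ab73e679, whose §2b
socket `h9` is K3⁷ v5's VERBATIM), COUNT-NEUTRAL; THEOREMS ONLY (0 `def`, 0 `sorry`, standard axioms).  Self-located in this seat's own lineage (CLAIM-1 on the bus, 2026-08-28T12:27Z):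
the g0′ pattern «J40 ↦ `…N22AtRecordOfKernelFadingPrinted` (p628066)» applied to J43.
CONTEXT.  dag-n22-c's LANE MAP OF RECORD (`README-N22C-LANE-MAP.md` §3) lists the producers of K3's N22 face `h9` by the currency of their young-coupling regularity datum.  J43
(`…N22AtRecordOfKernelFadingActivityMargins`, p628259) is the ACTIVITY-currency producer: node N18's kernel step rate supplies the geometric gain, the older-coordinate activity margins are
read with ONE radius `ϱ` ((2.38) letters `(A, R)` on the complex `ϱ`-discs — node N10's T-row complexified, [II] p. 12 (2.3); NOT printed), the last coordinate by node N09's `EHoloAt`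
families, all at the record's space tables `U^c_{k+1}(Z, cs.α₀, cs.α₁)` with J33's per-sub-polymer clause.  Its theorems display ONE binder that is neither an estimate row nor a datum of
record — `hEhol`, holomorphy of the (2.13) TERM through the complexified reading at every window history.  This lineage's `…N22AtRecordOfOutputCoordHoloPrinted` §0
`differentiableOn_E_comp_of_printedSlots` (p621851) derives exactly that from PRINTED (2.38) `Bound238` + Road 1's numerals + PRINTED `AnalyticH` + holomorphic readings mapping their
domain into the space of EVERY sub-polymer (dag-n22-c J30 v1.1's engine ∘ J32′ §1).  THIS FILE makes that substitution in J43 §3 — one application each — with the printed slots stated AT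
THE RECORD's SPACE TABLES `Z ↦ U^c_{k+1}(Z, cs.α₀, cs.α₁)` and with their OWN letters `(Aₚ, Rₚ, rₚ)` (J43's complex-disc margins keep `(A, R, r₁)`); J43's ball clause `hΦsp` is the
restriction of dag-n22-w3's sub-polymer clause on `U` along `ball 0 r ⊆ U`.  Nothing of J43 ∕ J40 ∕ p621851 is re-declared.

WHAT.  ★★★ `ne9_EA_objectsOfRecord₁₃_of_kernelStepRate_olderActivityCoordHolo_eHoloAt_analyticH` — `NE9 ((objectsOfRecord₁₃ F N θ ℓ).EA 0) (Window θ.γ) ℓ.κ ℓ.moduli` (K3's `h9`,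
the record's GEOMETRIC moduli) from: `ℓ.Signs`, `0 < θ.γ ≤ cs.γ`; node N18's `KernelStepRateOfRecord₁₃ F N θ κ₅ ℓ.θ₅ C₅` (`0 ≤ C₅`); W1-20's law `Localizes17OfRecord₁₃ F N θ S emb` for
towers `S K : ClusterTower (F.P K) 𝔸 M` (`M = L^{m′}`, `𝔸` a complete normed ℂ-algebra) at the settings `(Sg K, Rz K)` with Gaussian normalizations `logZ K` and β-letters `β K`; the
OLDER-coordinate activity margin datum `hO` (radius `ϱ`, letters `(A, R)` on the complex discs, Road 1's numerals for `(A, R, r₁)`); node N09's `EHoloAt (sfTowerOfRecord …) cs k`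
families with uniform `(E₀, r_E)`; common letters `ρ₀ ≤ ϱ∕2, r_E`, `B ≥ e·9·64·K₀(64,8)²·A, E₀`, `κ_E ≤ r₁, cs.κ`; PRINTED (2.38) `Bound238 (box θ.γ k) (Z ↦ U^c_{k+1}(Z)) Aₚ Rₚ` and
PRINTED `AnalyticH (box θ.γ k) (Z ↦ U^c_{k+1}(Z))` with Road 1's numerals for `(Aₚ, Rₚ, rₚ)`; HOLOMORPHIC complexified probe readings `Φ K k X` of the record's β-chart on open
`U K k X ⊇ ball 0 r` (chart clause `hΦemb`, dag-n22-w3's sub-polymer space clause `hΦsp` on `U`); site weights with the minimizer tails (`B₃`, `δ₀ > 0`: [I] p. 282, the sentence after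
(4.4)); `2κ₀(64,8) ≤ κ_w ≤ κ_E`; `PolLimitsExistOfRecord₁₃ F N θ`; rows `δ₁ ≤ κ₅`, `0 < ℓ.ω`, `ℓ.θ₅ ≤ ℓ.ω²`, `ℓ.κ ≤ δ₁`, `(4·(2C₅∕(1−ℓ.θ₅) + 2E₁)∕θ.γ + C₂·θ.γ∕2)∕ℓ.ω ≤ ℓ.C₉` (J40's
constants, `δ₁ = delta1 δ₀ κ_w (4M)`).  NO term-holomorphy hypothesis is displayed.
★★★ `n22At_rateCarriers_of_kernels_pin_of_kernelStepRate_olderActivityCoordHolo_eHoloAt_analyticH` — the N22 pin face `N22At (rateCarriersOfRecord₁₃CoPH 𝔯 F θ hP g₀ os k).u3` for EVERY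
`k` under `hpin`, from the same inputs at `θ.toStage13Params` (dag-n22-w3's `n22At_rateCarriers_of_kernels_pin_of_ne9`).
THE N22 ROW SENTENCE IN ACTIVITY CURRENCY, PRINT-LEVEL AND NON-VACUOUS AT THE JUNCTION: «N18's kernel step rate + older-coordinate activity margins with ONE radius + N09's `EHoloAt`
families + printed (2.38) + printed configuration analyticity + holomorphic minimizer readings + p. 282 tails + W1-20's law + (1.21) + letter rows satisfiable under `ℓ.Signs` (J42 §2
`exists_letterBlock_rows`) ⇒ K3's `h9` ∕ `N22At` with the record's geometric moduli, every run length».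

HONEST FRAMING (binding).  Count-neutral COMPOSITION of landed theorems by name; NO estimate of Bałaban's is proved or asserted; every displayed input is a HYPOTHESIS with its
owner (N18's kernel step rate: node N18 ∕ the N18 desks — NE5 NOT PRINTED for d = 4; older-coordinate activity margins on the complex discs: node N10's T-row COMPLEXIFIED in the older
couplings — inspection-level, NOT a printed display, NODE A at the towers of record; `EHoloAt` families: node N09 ([I] p. 263 «C^∞ … (or analytic)» read with a uniform margin);
printed (2.38) ∕ `AnalyticH`: N10 ∕ NODE A; readings + tails: NODE A ∕ N09; law: NODE A ∕ N10 ∕ def-W1; (1.21): dag-n22-w3's road); nothing of the record is constructed or claimed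
to meet them; N22 is NOT discharged (typed 28∕28 · discharged 5∕27 UNCHANGED); K3⁸ OPEN and NOT claimed (no stub of 27366 is touched); NE9 is NOT IN PRINT for d = 4; no count claim
(the chair's single count line is the only count); no summit statement is proved by this seat; one finite 𝕋⁴ programme at fixed ε — R4 closes the CONDITIONAL rung `BalabanLadder.UV`
only; NOTHING about the continuum limit, ℝ⁴, infinite volume, OS axioms, a mass gap or the Clay problem is proved or claimed by any of this.  A6: the antecedent is J43 §3's with
`hEhol` traded for print's slots; its letter rows are jointly satisfiable with `ℓ.Signs` (J42 §2), the kernel-fading road has dag-n22-w2's NON-DEGENERATE model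
(`…N22KernelFadingOfStepRateModelNonDegenerate`, p627338); the law, the margins, the `EHoloAt` families, `θ` and the reading OF RECORD are LOCATED hypotheses (inhabited by nothing of
the record yet) — the filing is LOCATED, not a discharge.  References (TYPES only, no cite tags on the Summit side): [I] = Bałaban, CMP 109 (1987) Thm 1 p. 259, (1.7) p. 261, §1 p. 263
with (1.18), (1.20)–(1.21) p. 264, §2 p. 266, p. 282 (site-weight tails: the sentence after (4.4)), (5.10) p. 293; [II] = CMP 116 (1988) (2.3) p. 12, (2.13)–(2.14) pp. 14–15, p. 15
(analyticity statement), Lemma 3 (2.38) p. 20, (2.41) p. 21; King, CMP 102 (1986) Lemma 4.5 (the N18 mechanism's print).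
-/

noncomputable section

open Filter Topology Metric Set
open scoped BigOperators

namespace YMDAG.N22.AtRecordOfPrintedSlots

open Literature.MathematicalPhysics.QuantumFieldTheory.Balaban1983to89
open Literature.MathematicalPhysics.QuantumFieldTheory.Balaban1983to89.T4Continuum (T4Family ULoop)
open Literature.MathematicalPhysics.QuantumFieldTheory.Balaban1983to89.T4OutputRate (Window NE9)
open Literature.MathematicalPhysics.QuantumFieldTheory.Balaban1983to89.B12TreeDecay (K₀ kappa₀)
open Literature.MathematicalPhysics.QuantumFieldTheory.Balaban1983to89.B12Decay510 (delta1)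
open Literature.MathematicalPhysics.QuantumFieldTheory.Balaban1983to89.B12Decay510Window (K₁)
open Literature.MathematicalPhysics.QuantumFieldTheory.Balaban1983to89.B12Decay510Torus (distCT nearT)
open Literature.MathematicalPhysics.QuantumFieldTheory.Balaban1983to89.B12BetaHolo (EHoloAt)
open Literature.MathematicalPhysics.QuantumFieldTheory.Balaban1983to89.TreeLengthTorus (TPt)
open Literature.MathematicalPhysics.QuantumFieldTheory.Balaban1983to89.Step (SFConsts)
open Literature.MathematicalPhysics.QuantumFieldTheory.Balaban1983to89.Node00 (Stage13Params Stage13HParams U3Letters₁₁ MatA)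
open Literature.MathematicalPhysics.QuantumFieldTheory.Balaban1983to89.Node00.Sect2 (domCount domSys CPair spaceI domSites Setting Residual)
open Literature.MathematicalPhysics.QuantumFieldTheory.Balaban1983to89.Node00.LocalizedSum17 (ReadingMaps Localizes17OfRecord₁₃)
open Literature.MathematicalPhysics.QuantumFieldTheory.Balaban1983to89.Node00.W1 (ClusterTower ClusterStep box sfTowerOfRecord)
open Literature.MathematicalPhysics.QuantumFieldTheory.Balaban1983to89.Node00.U3OfKernels (histPrefix objectsOfRecord₁₃)
open Literature.MathematicalPhysics.QuantumFieldTheory.Balaban1983to89.Node00.U3KernelLetters (KernelStepRateOfRecord₁₃ PolLimitsExistOfRecord₁₃)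
open YMDAG.UVSplit (N22At RateReading₁₃CoPH rateCarriersOfRecord₁₃CoPH)
open YMDAG.N22.AtKernels (n22At_rateCarriers_of_kernels_pin_of_ne9)
open YMDAG.N22.KernelFading (ne9_EA_objectsOfRecord₁₃_of_kernelStepRate_olderActivityCoordHolo_eHoloAt)

open scoped Matrix.Norms.L2Operator

variable (F : T4Family) (N : ℕ) [NeZero N]

open Classical in
/-- ★★★ **K3's `h9` WITH THE RECORD's GEOMETRIC MODULI, ACTIVITY CURRENCY, PRINT-LEVEL** — J43 §3's `ne9_EA_objectsOfRecord₁₃_of_kernelStepRate_olderActivityCoordHolo_eHoloAt` with the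
term-holomorphy binder `hEhol` DISCHARGED by p621851 §0 `differentiableOn_E_comp_of_printedSlots` at the record's space tables `Z ↦ U^c_{k+1}(Z, cs.α₀, cs.α₁)` (PRINTED (2.38) with
letters `(Aₚ, Rₚ)` + Road 1's numerals + PRINTED `AnalyticH` + holomorphic readings with dag-n22-w3's sub-polymer space clause on `U`), J43's ball clause read off along `ball 0 r ⊆ U`:
`ℓ.Signs` + `0 < θ.γ ≤ cs.γ` + node N18's `KernelStepRateOfRecord₁₃ F N θ κ₅ ℓ.θ₅ C₅` + law + OLDER-coordinate activity margins with ONE radius `ϱ` on the complex discs + node N09's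
`EHoloAt` families + common letters `ρ₀, B, κ_E` + `Bound238` ∕ `AnalyticH` on the boxes at the record's space tables + numerals + holomorphic readings + tails + `PolLimitsExistOfRecord₁₃ F N θ`
+ J40's rows ⟹ `NE9 ((objectsOfRecord₁₃ F N θ ℓ).EA 0) (Window θ.γ) ℓ.κ ℓ.moduli`.  LOCATED (hypothesis form); N22 NOT discharged. -/
theorem ne9_EA_objectsOfRecord₁₃_of_kernelStepRate_olderActivityCoordHolo_eHoloAt_analyticH (θ : Stage13Params F N) (ℓ : U3Letters₁₁) (hs : ℓ.Signs) (hγ0 : 0 < θ.γ)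
    (hlim : PolLimitsExistOfRecord₁₃ F N θ) {κ₅ C₅ : ℝ} (hC₅ : 0 ≤ C₅) (h5 : KernelStepRateOfRecord₁₃ F N θ κ₅ ℓ.θ₅ C₅)
    {𝔸 : Type*} [NormedRing 𝔸] [NormedAlgebra ℂ 𝔸] [CompleteSpace 𝔸] {G : Type*} [GaugeGroup G]
    (m' : ℕ) (M : ℕ) [NeZero M] (hM : M = F.L ^ m')
    (S : (K : ℕ) → ClusterTower (F.P K) 𝔸 M) (emb : ReadingMaps F (MatA N) 𝔸) (hloc : Localizes17OfRecord₁₃ F N θ S emb)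
    (Sg : (K : ℕ) → Setting 𝔸 G) (Rz : (K : ℕ) → Residual (F.P K) 𝔸) (logZ : (K : ℕ) → ℕ → GaugeField (F.P K) 0 G → ℝ) (β : ℕ → ℕ → ℝ → ℝ)
    (cs : SFConsts) (hγ : θ.γ ≤ cs.γ)
    {ϱ A R r₁ rE E₀ ρ₀ B κE κw δ₀ B₃ r Aₚ Rₚ rₚ : ℝ} (hϱ : 0 < ϱ) (hA : 0 ≤ A) (hr₁ : 0 ≤ r₁) (hrate : r₁ + 2 * (64 * Real.log 162) + 2 ≤ R)
    (hsmall : A * Real.exp (5 * r₁ + 1) * K₀ 64 8 * 9 * 64 ≤ 1) (hρ₀ : 0 < ρ₀) (hρ₀ϱ : ρ₀ ≤ ϱ / 2) (hρ₀E : ρ₀ ≤ rE)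
    (hBA : Real.exp 1 * 9 * 64 * K₀ 64 8 ^ 2 * A ≤ B) (hBE : E₀ ≤ B) (hE₀ : 0 ≤ E₀) (hκr : κE ≤ r₁) (hκc : κE ≤ cs.κ)
    (hκ₀ : kappa₀ (4 * 2 ^ 4) (2 * 4) ≤ κw / 2) (hκw : κw ≤ κE) (hδ₀ : 0 < δ₀) (hB₃ : 0 ≤ B₃) (hr : 0 < r)
    (hO : ∀ (K k : ℕ), ∀ g ∈ box θ.γ k, ∀ (Z : (domSys (F.P K) M (k + 1)).Dom),
      ∀ φ ∈ spaceI (Sg K) (Rz K) M (k + 1) (domSites (F.P K) M (k + 1) Z) cs.α₀ cs.α₁, ∀ i : Fin (k + 1), (i : ℕ) < k →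
      ∃ (Hc : ℂ → ℂ) (O : Set ℂ), DifferentiableOn ℂ Hc O ∧ (∀ t ∈ Ioc (0 : ℝ) θ.γ, closedBall (t : ℂ) ϱ ⊆ O) ∧
        (∀ z ∈ O, ‖Hc z‖ ≤ A * Real.exp (-(R * (domSys (F.P K) M (k + 1)).dj Z))) ∧
        (∀ t ∈ Ioc (0 : ℝ) θ.γ, Hc t = ((S K) k).H (Function.update g i t) φ Z))
    (hE : ∀ (K : ℕ), ∀ g ∈ Window θ.γ, ∀ k : ℕ, ∃ H : EHoloAt (sfTowerOfRecord (Sg K) (Rz K) M (S K) ⟨g, β K⟩ (logZ K)) cs k, H.E₀ ≤ E₀ ∧ rE ≤ H.r)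
    (hAₚ : 0 ≤ Aₚ) (hrₚ : 0 ≤ rₚ) (hrateₚ : rₚ + 2 * (64 * Real.log 162) + 2 ≤ Rₚ) (hsmallₚ : Aₚ * Real.exp (5 * rₚ + 1) * K₀ 64 8 * 9 * 64 ≤ 1)
    (h238 : ∀ K k, ((S K) k).Bound238 (box θ.γ k) (fun Z => spaceI (Sg K) (Rz K) M (k + 1) (domSites (F.P K) M (k + 1) Z) cs.α₀ cs.α₁) Aₚ Rₚ)
    (hAn : ∀ K k, ((S K) k).AnalyticH (box θ.γ k) (fun Z => spaceI (Sg K) (Rz K) M (k + 1) (domSites (F.P K) M (k + 1) Z) cs.α₀ cs.α₁))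
    (Ec : ℕ → ℕ → Type*) [∀ K k, NormedAddCommGroup (Ec K k)] [∀ K k, NormedSpace ℂ (Ec K k)]
    (ι : letI := θ.instVβ₁; letI := θ.instVβ₂
      (K k : ℕ) → (domSys (F.P K) M (k + 1)).Dom → ((Fin (F.P K).d → Site (F.P K) (k + 1) → θ.Vβ) →L[ℝ] Ec K k))
    (Φ : (K k : ℕ) → (domSys (F.P K) M (k + 1)).Dom → Ec K k → CPair (F.P K) 𝔸)
    (U : (K k : ℕ) → (domSys (F.P K) M (k + 1)).Dom → Set (Ec K k)) (hU : ∀ K k X, IsOpen (U K k X)) (hrU : ∀ K k X, ball (0 : Ec K k) r ⊆ U K k X)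
    (hΦhol : ∀ (K k : ℕ) (X : (domSys (F.P K) M (k + 1)).Dom), DifferentiableOn ℂ (Φ K k X) (U K k X))
    (hΦemb : letI := θ.instVβ₁; letI := θ.instVβ₂
      ∀ (K k : ℕ) (X : (domSys (F.P K) M (k + 1)).Dom) (Bf : Fin (F.P K).d → Site (F.P K) (k + 1) → θ.Vβ),
        Φ K k X (ι K k X Bf) = emb K k (fun l t => NormedSpace.exp (θ.ρ8 (Bf l t))))
    (hΦsp : ∀ (K k : ℕ) (X : (domSys (F.P K) M (k + 1)).Dom), ∀ z ∈ U K k X, ∀ Z : (domSys (F.P K) M (k + 1)).Dom, Z.1 ⊆ X.1 →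
      Φ K k X z ∈ spaceI (Sg K) (Rz K) M (k + 1) (domSites (F.P K) M (k + 1) Z) cs.α₀ cs.α₁)
    (w : (K k : ℕ) → (domSys (F.P K) M (k + 1)).Dom → Site (F.P K) (k + 1) → ℝ) (hw₀ : ∀ K k X t, 0 ≤ w K k X t)
    (hw : letI := θ.instVβ₁; letI := θ.instVβ₂; letI := θ.instιβ
      ∀ (K k : ℕ) (X : (domSys (F.P K) M (k + 1)).Dom) (l : Fin (F.P K).d) (t : Site (F.P K) (k + 1)) (cc : θ.ιβ),
        ‖ι K k X (Pi.single l (Pi.single t (θ.bV cc)))‖ ≤ w K k X t)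
    (htail : ∀ (K k : ℕ) (X : (domSys (F.P K) M (k + 1)).Dom) (t : Site (F.P K) (k + 1)),
      let e : Site (F.P K) (k + 1) → TPt 4 (domCount (F.P K) M (k + 1) * M) := fun x i => (ZMod.cast (x i) : ZMod (domCount (F.P K) M (k + 1) * M))
      w K k X t ≤ B₃ * Real.exp (-δ₀ * distCT (domCount (F.P K) M (k + 1)) M (e t) (nearT (M := M) (e t) X)))
    (hκ₅ : delta1 δ₀ κw ((M : ℝ) * 4) ≤ κ₅) (hω : 0 < ℓ.ω) (hθω : ℓ.θ₅ ≤ ℓ.ω ^ 2) (hℓκ : ℓ.κ ≤ delta1 δ₀ κw ((M : ℝ) * 4))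
    (hC₉ : (4 * (2 * C₅ / (1 - ℓ.θ₅) +
        2 * ((16 * B * B₃ ^ 2 / r ^ 2) * Real.exp (delta1 δ₀ κw ((M : ℝ) * 4) * ((M : ℝ) * 4) * 3) * K₀ (4 * 2 ^ 4) (2 * 4) * K₁ 4 (δ₀ / 2))) / θ.γ +
        ((16 * (64 * B / ρ₀ ^ 2) * B₃ ^ 2 / r ^ 2) * Real.exp (delta1 δ₀ κw ((M : ℝ) * 4) * ((M : ℝ) * 4) * 3) * K₀ (4 * 2 ^ 4) (2 * 4) *
          K₁ 4 (δ₀ / 2)) * θ.γ / 2) / ℓ.ω ≤ ℓ.C₉) :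
    NE9 ((objectsOfRecord₁₃ F N θ ℓ).EA 0) (Window θ.γ) ℓ.κ ℓ.moduli :=
  ne9_EA_objectsOfRecord₁₃_of_kernelStepRate_olderActivityCoordHolo_eHoloAt F N θ ℓ hs hγ0 hlim hC₅ h5 m' M hM S emb hloc Sg Rz logZ β cs hγ
    hϱ hA hr₁ hrate hsmall hρ₀ hρ₀ϱ hρ₀E hBA hBE hE₀ hκr hκc hκ₀ hκw hδ₀ hB₃ hr hO hE Ec ι Φ U hU hrU
    (differentiableOn_E_comp_of_printedSlots F S (fun K k Z => spaceI (Sg K) (Rz K) M (k + 1) (domSites (F.P K) M (k + 1) Z) cs.α₀ cs.α₁)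
      hAₚ hrₚ hrateₚ hsmallₚ h238 hAn Ec Φ U hU hΦhol hΦsp)
    hΦemb (fun K k X z hz Z hZ => hΦsp K k X z (hrU K k X hz) Z hZ) w hw₀ hw htail hκ₅ hω hθω hℓκ hC₉

open Classical in
/-- ★★★ **THE N22 PIN FACE, ACTIVITY CURRENCY, PRINT-LEVEL AND NON-VACUOUS AT THE JUNCTION** — `N22At (rateCarriersOfRecord₁₃CoPH 𝔯 F θ hP g₀ os k).u3` for EVERY `k` under `hpin`:
`ne9_EA_objectsOfRecord₁₃_of_kernelStepRate_olderActivityCoordHolo_eHoloAt_analyticH` at `θ.toStage13Params` fed to dag-n22-w3's `n22At_rateCarriers_of_kernels_pin_of_ne9`.  «N18's kernel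
step rate + older-coordinate activity margins with ONE radius + N09's `EHoloAt` families + printed (2.38) + printed configuration analyticity + holomorphic minimizer readings + p. 282
tails + law + (1.21) + letter rows ⇒ `N22At` with the record's geometric moduli, every run length».  LOCATED (hypothesis form); N22 NOT discharged. -/
theorem n22At_rateCarriers_of_kernels_pin_of_kernelStepRate_olderActivityCoordHolo_eHoloAt_analyticH (𝔯 : RateReading₁₃CoPH N) (θ : Stage13HParams F N)
    (hP : θ.Provisos₁₃CoPH F N) (g₀ : ℕ → ℝ) (os : List (ULoop F)) (ℓ : U3Letters₁₁) (hs : ℓ.Signs) (hγ0 : 0 < θ.γ)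
    (hpin : (𝔯.lit F θ hP g₀ os).u3 = objectsOfRecord₁₃ F N θ.toStage13Params ℓ)
    (hlim : PolLimitsExistOfRecord₁₃ F N θ.toStage13Params) {κ₅ C₅ : ℝ} (hC₅ : 0 ≤ C₅) (h5 : KernelStepRateOfRecord₁₃ F N θ.toStage13Params κ₅ ℓ.θ₅ C₅)
    {𝔸 : Type*} [NormedRing 𝔸] [NormedAlgebra ℂ 𝔸] [CompleteSpace 𝔸] {G : Type*} [GaugeGroup G]
    (m' : ℕ) (M : ℕ) [NeZero M] (hM : M = F.L ^ m')
    (S : (K : ℕ) → ClusterTower (F.P K) 𝔸 M) (emb : ReadingMaps F (MatA N) 𝔸) (hloc : Localizes17OfRecord₁₃ F N θ.toStage13Params S emb)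
    (Sg : (K : ℕ) → Setting 𝔸 G) (Rz : (K : ℕ) → Residual (F.P K) 𝔸) (logZ : (K : ℕ) → ℕ → GaugeField (F.P K) 0 G → ℝ) (β : ℕ → ℕ → ℝ → ℝ)
    (cs : SFConsts) (hγ : θ.γ ≤ cs.γ)
    {ϱ A R r₁ rE E₀ ρ₀ B κE κw δ₀ B₃ r Aₚ Rₚ rₚ : ℝ} (hϱ : 0 < ϱ) (hA : 0 ≤ A) (hr₁ : 0 ≤ r₁) (hrate : r₁ + 2 * (64 * Real.log 162) + 2 ≤ R)
    (hsmall : A * Real.exp (5 * r₁ + 1) * K₀ 64 8 * 9 * 64 ≤ 1) (hρ₀ : 0 < ρ₀) (hρ₀ϱ : ρ₀ ≤ ϱ / 2) (hρ₀E : ρ₀ ≤ rE)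
    (hBA : Real.exp 1 * 9 * 64 * K₀ 64 8 ^ 2 * A ≤ B) (hBE : E₀ ≤ B) (hE₀ : 0 ≤ E₀) (hκr : κE ≤ r₁) (hκc : κE ≤ cs.κ)
    (hκ₀ : kappa₀ (4 * 2 ^ 4) (2 * 4) ≤ κw / 2) (hκw : κw ≤ κE) (hδ₀ : 0 < δ₀) (hB₃ : 0 ≤ B₃) (hr : 0 < r)
    (hO : ∀ (K k : ℕ), ∀ g ∈ box θ.γ k, ∀ (Z : (domSys (F.P K) M (k + 1)).Dom),
      ∀ φ ∈ spaceI (Sg K) (Rz K) M (k + 1) (domSites (F.P K) M (k + 1) Z) cs.α₀ cs.α₁, ∀ i : Fin (k + 1), (i : ℕ) < k →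
      ∃ (Hc : ℂ → ℂ) (O : Set ℂ), DifferentiableOn ℂ Hc O ∧ (∀ t ∈ Ioc (0 : ℝ) θ.γ, closedBall (t : ℂ) ϱ ⊆ O) ∧
        (∀ z ∈ O, ‖Hc z‖ ≤ A * Real.exp (-(R * (domSys (F.P K) M (k + 1)).dj Z))) ∧
        (∀ t ∈ Ioc (0 : ℝ) θ.γ, Hc t = ((S K) k).H (Function.update g i t) φ Z))
    (hE : ∀ (K : ℕ), ∀ g ∈ Window θ.γ, ∀ k : ℕ, ∃ H : EHoloAt (sfTowerOfRecord (Sg K) (Rz K) M (S K) ⟨g, β K⟩ (logZ K)) cs k, H.E₀ ≤ E₀ ∧ rE ≤ H.r)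
    (hAₚ : 0 ≤ Aₚ) (hrₚ : 0 ≤ rₚ) (hrateₚ : rₚ + 2 * (64 * Real.log 162) + 2 ≤ Rₚ) (hsmallₚ : Aₚ * Real.exp (5 * rₚ + 1) * K₀ 64 8 * 9 * 64 ≤ 1)
    (h238 : ∀ K k, ((S K) k).Bound238 (box θ.γ k) (fun Z => spaceI (Sg K) (Rz K) M (k + 1) (domSites (F.P K) M (k + 1) Z) cs.α₀ cs.α₁) Aₚ Rₚ)
    (hAn : ∀ K k, ((S K) k).AnalyticH (box θ.γ k) (fun Z => spaceI (Sg K) (Rz K) M (k + 1) (domSites (F.P K) M (k + 1) Z) cs.α₀ cs.α₁))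
    (Ec : ℕ → ℕ → Type*) [∀ K k, NormedAddCommGroup (Ec K k)] [∀ K k, NormedSpace ℂ (Ec K k)]
    (ι : letI := θ.instVβ₁; letI := θ.instVβ₂
      (K k : ℕ) → (domSys (F.P K) M (k + 1)).Dom → ((Fin (F.P K).d → Site (F.P K) (k + 1) → θ.Vβ) →L[ℝ] Ec K k))
    (Φ : (K k : ℕ) → (domSys (F.P K) M (k + 1)).Dom → Ec K k → CPair (F.P K) 𝔸)
    (U : (K k : ℕ) → (domSys (F.P K) M (k + 1)).Dom → Set (Ec K k)) (hU : ∀ K k X, IsOpen (U K k X)) (hrU : ∀ K k X, ball (0 : Ec K k) r ⊆ U K k X)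
    (hΦhol : ∀ (K k : ℕ) (X : (domSys (F.P K) M (k + 1)).Dom), DifferentiableOn ℂ (Φ K k X) (U K k X))
    (hΦemb : letI := θ.instVβ₁; letI := θ.instVβ₂
      ∀ (K k : ℕ) (X : (domSys (F.P K) M (k + 1)).Dom) (Bf : Fin (F.P K).d → Site (F.P K) (k + 1) → θ.Vβ),
        Φ K k X (ι K k X Bf) = emb K k (fun l t => NormedSpace.exp (θ.ρ8 (Bf l t))))
    (hΦsp : ∀ (K k : ℕ) (X : (domSys (F.P K) M (k + 1)).Dom), ∀ z ∈ U K k X, ∀ Z : (domSys (F.P K) M (k + 1)).Dom, Z.1 ⊆ X.1 →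
      Φ K k X z ∈ spaceI (Sg K) (Rz K) M (k + 1) (domSites (F.P K) M (k + 1) Z) cs.α₀ cs.α₁)
    (w : (K k : ℕ) → (domSys (F.P K) M (k + 1)).Dom → Site (F.P K) (k + 1) → ℝ) (hw₀ : ∀ K k X t, 0 ≤ w K k X t)
    (hw : letI := θ.instVβ₁; letI := θ.instVβ₂; letI := θ.instιβ
      ∀ (K k : ℕ) (X : (domSys (F.P K) M (k + 1)).Dom) (l : Fin (F.P K).d) (t : Site (F.P K) (k + 1)) (cc : θ.ιβ),
        ‖ι K k X (Pi.single l (Pi.single t (θ.bV cc)))‖ ≤ w K k X t)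
    (htail : ∀ (K k : ℕ) (X : (domSys (F.P K) M (k + 1)).Dom) (t : Site (F.P K) (k + 1)),
      let e : Site (F.P K) (k + 1) → TPt 4 (domCount (F.P K) M (k + 1) * M) := fun x i => (ZMod.cast (x i) : ZMod (domCount (F.P K) M (k + 1) * M))
      w K k X t ≤ B₃ * Real.exp (-δ₀ * distCT (domCount (F.P K) M (k + 1)) M (e t) (nearT (M := M) (e t) X)))
    (hκ₅ : delta1 δ₀ κw ((M : ℝ) * 4) ≤ κ₅) (hω : 0 < ℓ.ω) (hθω : ℓ.θ₅ ≤ ℓ.ω ^ 2) (hℓκ : ℓ.κ ≤ delta1 δ₀ κw ((M : ℝ) * 4))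
    (hC₉ : (4 * (2 * C₅ / (1 - ℓ.θ₅) +
        2 * ((16 * B * B₃ ^ 2 / r ^ 2) * Real.exp (delta1 δ₀ κw ((M : ℝ) * 4) * ((M : ℝ) * 4) * 3) * K₀ (4 * 2 ^ 4) (2 * 4) * K₁ 4 (δ₀ / 2))) / θ.γ +
        ((16 * (64 * B / ρ₀ ^ 2) * B₃ ^ 2 / r ^ 2) * Real.exp (delta1 δ₀ κw ((M : ℝ) * 4) * ((M : ℝ) * 4) * 3) * K₀ (4 * 2 ^ 4) (2 * 4) *
          K₁ 4 (δ₀ / 2)) * θ.γ / 2) / ℓ.ω ≤ ℓ.C₉)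
    (k : ℕ) : N22At (rateCarriersOfRecord₁₃CoPH 𝔯 F θ hP g₀ os k).u3 :=
  n22At_rateCarriers_of_kernels_pin_of_ne9 𝔯 θ hP g₀ os ℓ hs hpin
    (ne9_EA_objectsOfRecord₁₃_of_kernelStepRate_olderActivityCoordHolo_eHoloAt_analyticH F N θ.toStage13Params ℓ hs hγ0 hlim hC₅ h5 m' M hM S emb hloc Sg Rz logZ β cs hγ
      hϱ hA hr₁ hrate hsmall hρ₀ hρ₀ϱ hρ₀E hBA hBE hE₀ hκr hκc hκ₀ hκw hδ₀ hB₃ hr hO hE hAₚ hrₚ hrateₚ hsmallₚ h238 hAn Ec ι Φ U hU hrU hΦhol hΦemb hΦsp w hw₀ hw htail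
      hκ₅ hω hθω hℓκ hC₉) k

end YMDAG.N22.AtRecordOfPrintedSlots

end
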